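import Literature.Analysis.FluidPDE.NSVorticityDifference
import Literature.Analysis.FluidPDE.TaoEnstrophyLocalisationProofs
import Literature.Analysis.FluidPDE.SobolevWholeSpace
import Literature.Analysis.FluidPDE.NSWeakStrongUniqueness
import Literature.Analysis.FluidPDE.ClassicalSolutionCalculus
import Literature.Analysis.FluidPDE.NSUnconditionalUniquenessProofs
import HarnessLib

/-!
# Uniqueness of classical Navier–Stokes solutions on `ℝ³` in Tao's class `X¹`

Analysis/FluidPDE support file. Main result (`IsClassicalNSSolutionOn.eq_of_memSobolevX`): two
classical solutions `(u, p)`, `(v, q)` of the Navier–Stokes system on `[0, T] × ℝ³` with the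
same viscosity `ν > 0`, the same smooth forcing `f` and the same datum `u(0) = v(0)`, both in
Tao's class `X¹([0,T] × ℝ³) = L^∞_t H¹_x ∩ L²_t H²_x` (`NS.MemSobolevX 1 T`), coincide on
`[0, T]`; no hypothesis on the pressures is made. With `f = 0` this is exactly the named fact
`NS.tao2011_velocity_eq_of_memSobolevX` of `NSUnconditionalUniquenessProofs.lean`, i.e. the
conjunction of Tao 2011, Cor. 4.3 (an almost smooth `H¹` solution is, after normalising the
pressure, a mild `H¹` solution) and Thm. 5.4 (iii) (mild `H¹` solutions are unique) used in
Remark 11.3 for the unconditional uniqueness Cor. 11.4. The final section `Discharges` records the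
consequences for the decomposition of Cor. 11.4 kept in `NSUnconditionalUniquenessProofs.lean`
(imported here; that file has a dependent, `TaoEnstrophyLocalisationParts.lean`, so the discharges
live in the present new file rather than being appended there), all **proved**:

* `NS.tao2011_velocity_eq_of_memSobolevX_holds` (the Cor. 4.3 + Thm. 5.4 (iii) composite) and
  `NS.tao2011_velocity_eq_of_isMildNSSolutionOn_holds` (the Thm. 5.4 (iii) node, a formal
  consequence of the composite by `NS.tao2011_velocity_eq_of_isMildNSSolutionOn_of_memSobolevX`);
* `NS.tao_unconditional_uniqueness_velocity_of_boundedEnstrophy :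
    tao2011_boundedEnstrophy → tao_unconditional_uniqueness_velocity` — with steps 2–3 of
  Remark 11.3's chain discharged, Cor. 11.4 (velocity form) hinges on Cor. 11.1 alone;
* `NS.tao_unconditional_uniqueness_velocity_of_enstrophyLocalisation :
    tao2011_enstrophyLocalisation_exterior → tao_unconditional_uniqueness_velocity` and the same
  for Cor. 11.4 as printed together with the duplicate vendoring
  `tao_finite_energy_velocity_uniqueness` — since `TaoEnstrophyLocalisation.lean` proves Cor. 11.1
  from Thm. 10.1 (exterior form) and the Fourier step `tao2011_sobolev_of_vorticity`, discharged
  in `TaoEnstrophyLocalisationProofs.lean`, the single remaining named fact behind all three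
  vendored forms of Cor. 11.4 at this layer is `NS.tao2011_enstrophyLocalisation_exterior`
  (Thm. 10.1; reduced further to Lemma 8.1, Prop. 9.1 and the a priori form of §10 in
  `TaoEnstrophyLocalisationParts.lean`, whose `tao_unconditional_uniqueness_of_leaves` can now be
  fed `tao2011_velocity_eq_of_memSobolevX_holds`).

## Method

Not Tao's (heat-semigroup `X¹` theory for mild solutions), but the classical **vorticity energy
method for the difference** `w = u − v` (Majda–Bertozzi, *Vorticity and Incompressible Flow*,
§3.2; Constantin–Foias, *Navier–Stokes Equations*, Ch. 10), which proves the same statement and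
never sees the pressure:

1. (`NSVorticityDifference.lean`) `ω = curl w` satisfies `∂ₜω = νΔω − curl G`,
   `G = (u·∇)w + (w·∇)v`, whence the enstrophy inequality
   `‖ω(t)‖² + 2ν∫₀ᵗ‖∇ω‖² ≤ 2∫₀ᵗ∫|G| |curl ω|` (`IsClassicalNSSolutionOn.enstrophy_sub_le`),
   valid once `sup_t ‖ω‖² < ∞`, `∇ω ∈ L²_{t,x}` and `G ∈ L²_{t,x}`.
2. (here, `APriori`) these three a priori bounds follow from `u, v ∈ X¹`: the transport bound
   `‖G‖²_{L²} ≲ A ‖ω‖ ‖∇ω‖ + B^{1/2} ‖D²v‖ ‖ω‖²` (`exists_lintegral_transport_sq_le`: Hölder with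
   exponents `(2, 6, 3) ↦ (1/2, 1/6, 1/3)`, the Sobolev inequality `Ḣ¹ ⊂ L⁶` on `ℝ³` twice
   (`SobolevWholeSpace.lean`) and the `div`–`curl` estimates `‖∇w‖ ≲ ‖curl w‖`,
   `‖D²w‖ ≲ ‖∇ curl w‖` of `NS.tao2011_sobolev_of_vorticity_holds`).
3. (here, `exists_slice_estimate_sub`) Cauchy–Schwarz, `|curl ω| ≤ κ‖∇ω‖` and Young twice give
   `2∫|G| |curl ω| ≤ ν‖∇ω‖²_F + (K₃ + K₄‖D²v(τ)‖_{L²}) ‖ω‖²`; the dissipation is absorbed and the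
   integral Grönwall lemma with the integrable kernel `K₃ + K₄‖D²v(τ)‖_{L²}`
   (`NS.lintegral_gronwall_eq_zero`, all in `[0, ∞]`) gives `ω ≡ 0`.
4. (here, `eq_zero_of_lintegral_curl_sq_eq_zero`) a smooth divergence-free `L²` field with
   `curl w = 0` has `∇w = 0` (div–curl), is constant, hence `0` (`ℝ³` has infinite volume).

## Mathlib / tree search

Mathlib has no Navier–Stokes theory (`lean search 'NavierStokes|enstrophy'` in Mathlib: none).
Tree: the weak–strong uniqueness file `NSWeakStrongUniqueness.lean` proves the `ℝ≥0∞` Grönwall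
lemma and Young absorption used here but concerns Leray–Hopf weak solutions under a Serrin
condition (named facts); `NSUnconditionalUniquenessProofs.lean` has the assembly of Cor. 11.4 from
named facts; nothing proves uniqueness in `X¹` (`lean search 'velocity_eq|memSobolevX'`).

## References

* T. Tao, *Localisation and compactness properties of the Navier–Stokes global regularity
  problem*, Anal. PDE 6 (2013), 25–107, arXiv:1108.1165; Cor. 4.3, Thm. 5.4 (iii), Remark 11.3,
  Cor. 11.4. [Tao2011]
* A. J. Majda, A. L. Bertozzi, *Vorticity and Incompressible Flow*, Cambridge Texts in Applied
  Mathematics 27, CUP 2002, §3.2 (energy method for the vorticity of the difference).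
* P. Constantin, C. Foias, *Navier–Stokes Equations*, Chicago Lectures in Mathematics, 1988,
  Ch. 10 (uniqueness of strong solutions).
-/

noncomputable section

open MeasureTheory Set Function Filter Topology InnerProductSpace Module
open scoped RealInnerProductSpace ENNReal NNReal ContDiff

namespace Literature.Analysis.FluidPDE

/-! ### Pointwise and `L²` tools on `ℝ³` -/


/-- `‖L a‖ₑ² ≤ ‖L‖ₑ² ‖a‖ₑ²` (operator norm bound, squared, in `ℝ≥0∞`). [folklore] -/
theorem enorm_apply_sq_le (L : EuclideanSpace ℝ (Fin 3) →L[ℝ] EuclideanSpace ℝ (Fin 3)) (a : EuclideanSpace ℝ (Fin 3)) :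
    ‖L a‖ₑ ^ 2 ≤ ‖L‖ₑ ^ 2 * ‖a‖ₑ ^ 2 := by
  rw [← mul_pow]
  gcongr
  rw [← ofReal_norm, ← ofReal_norm, ← ofReal_norm, ← ENNReal.ofReal_mul (norm_nonneg _)]
  exact ENNReal.ofReal_le_ofReal (L.le_opNorm a)

/-- **The convective `L²` bound on `ℝ³`**: there is an absolute `C` with
`∫ ‖Dz(x)(a(x))‖² ≤ C ‖Dz‖_{L²} ‖D²z‖_{L²} ‖Da‖²_{L²}` for `a ∈ C¹ ∩ L²`, `z ∈ C²` with
`Dz ∈ L²` (right side possibly infinite): Hölder with exponents `(1/2, 1/6, 1/3)` applied to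
`‖Dz‖² = (‖Dz‖²)^{1/2} (‖Dz‖⁶)^{1/6}`, `‖a‖² = (‖a‖⁶)^{1/3}`, then the Sobolev inequality
`‖g‖_{L⁶} ≤ K ‖Dg‖_{L²}` (`eLpNorm_six_le_eLpNorm_fderiv_two`, `SobolevWholeSpace.lean`) for
`g = Dz` and `g = a`; i.e. `‖(a·∇)z‖_{L²} ≲ ‖∇z‖_{L³}‖a‖_{L⁶} ≤ ‖∇z‖^{1/2}_{L²}‖∇z‖^{1/2}_{L⁶}‖a‖_{L⁶}`
(Constantin–Foias, Ch. 10, the estimate of the trilinear form). [folklore] -/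
theorem exists_lintegral_enorm_fderiv_apply_sq_le :
    ∃ C : ℝ≥0, ∀ (a z : EuclideanSpace ℝ (Fin 3) → EuclideanSpace ℝ (Fin 3)), ContDiff ℝ 1 a → ContDiff ℝ 2 z →
      ∫⁻ x, ‖a x‖ₑ ^ 2 < ⊤ → ∫⁻ x, ‖fderiv ℝ z x‖ₑ ^ 2 < ⊤ →
      ∫⁻ x, ‖fderiv ℝ z x (a x)‖ₑ ^ 2 ≤
        C * ((∫⁻ x, ‖fderiv ℝ z x‖ₑ ^ 2) ^ (1 / 2 : ℝ) *
          (∫⁻ x, ‖iteratedFDeriv ℝ 2 z x‖ₑ ^ 2) ^ (1 / 2 : ℝ) * ∫⁻ x, ‖fderiv ℝ a x‖ₑ ^ 2) := by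
  set K₁ : ℝ≥0 := SNormLESNormFDerivOfEqConst (EuclideanSpace ℝ (Fin 3)) (volume : Measure (EuclideanSpace ℝ (Fin 3))) 2 with hK₁
  set K₂ : ℝ≥0 := SNormLESNormFDerivOfEqConst (EuclideanSpace ℝ (Fin 3) →L[ℝ] EuclideanSpace ℝ (Fin 3)) (volume : Measure (EuclideanSpace ℝ (Fin 3))) 2 with hK₂
  have hE : finrank ℝ (EuclideanSpace ℝ (Fin 3)) = 3 := finrank_euclideanSpace_fin
  refine ⟨K₂ * K₁ ^ 2, fun a z ha hz ha2 hDz2 => ?_⟩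
  have hz1 : ContDiff ℝ 1 z := hz.of_le one_le_two
  have hDz1 : ContDiff ℝ 1 (fderiv ℝ z) := hz.fderiv_right (m := 1) le_rfl
  -- measurability
  have mDz : AEMeasurable (fun x => ‖fderiv ℝ z x‖ₑ) (volume : Measure (EuclideanSpace ℝ (Fin 3))) :=
    (hz1.continuous_fderiv one_ne_zero).aestronglyMeasurable.enorm
  have ma : AEMeasurable (fun x => ‖a x‖ₑ) (volume : Measure (EuclideanSpace ℝ (Fin 3))) :=
    ha.continuous.aestronglyMeasurable.enorm
  -- the three factors and weights
  set f1 : EuclideanSpace ℝ (Fin 3) → ℝ≥0∞ := fun x => ‖fderiv ℝ z x‖ₑ ^ (2 : ℝ) with hf1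
  set f2 : EuclideanSpace ℝ (Fin 3) → ℝ≥0∞ := fun x => ‖fderiv ℝ z x‖ₑ ^ (6 : ℝ) with hf2
  set f3 : EuclideanSpace ℝ (Fin 3) → ℝ≥0∞ := fun x => ‖a x‖ₑ ^ (6 : ℝ) with hf3
  set F : Fin 3 → EuclideanSpace ℝ (Fin 3) → ℝ≥0∞ := ![f1, f2, f3] with hF
  set P : Fin 3 → ℝ := ![1 / 2, 1 / 6, 1 / 3] with hP
  have hPsum : ∑ i, P i = 1 := by
    simp only [Fin.sum_univ_three, hP, Matrix.cons_val_zero, Matrix.cons_val_one, Matrix.cons_val]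
    norm_num
  have hPnn : ∀ i ∈ (Finset.univ : Finset (Fin 3)), 0 ≤ P i := by
    intro i _; fin_cases i <;> norm_num [hP]
  have hFm : ∀ i ∈ (Finset.univ : Finset (Fin 3)), AEMeasurable (F i) volume := by
    intro i _
    fin_cases i
    exacts [mDz.pow_const _, mDz.pow_const _, ma.pow_const _]
  have hH := ENNReal.lintegral_prod_norm_pow_le Finset.univ hFm hPsum hPnn
  simp only [Fin.prod_univ_three] at hH
  -- pointwise domination
  have hpt : ∀ x, ‖fderiv ℝ z x (a x)‖ₑ ^ 2 ≤ F 0 x ^ P 0 * F 1 x ^ P 1 * F 2 x ^ P 2 := by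
    intro x
    have e1 : ‖fderiv ℝ z x‖ₑ ^ 2 = f1 x ^ (1 / 2 : ℝ) * f2 x ^ (1 / 6 : ℝ) := by
      rw [hf1, hf2]
      simp only
      rw [← ENNReal.rpow_mul, ← ENNReal.rpow_mul, ← ENNReal.rpow_add_of_nonneg _ _ (by norm_num)
        (by norm_num), ← ENNReal.rpow_two]
      norm_num
    have e2 : ‖a x‖ₑ ^ 2 = f3 x ^ (1 / 3 : ℝ) := by
      rw [hf3]
      simp only
      rw [← ENNReal.rpow_mul, ← ENNReal.rpow_two]
      norm_num
    calc ‖fderiv ℝ z x (a x)‖ₑ ^ 2 ≤ ‖fderiv ℝ z x‖ₑ ^ 2 * ‖a x‖ₑ ^ 2 := enorm_apply_sq_le _ _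
      _ = F 0 x ^ P 0 * F 1 x ^ P 1 * F 2 x ^ P 2 := by
          rw [e1, e2]
          simp only [hF, hP, Matrix.cons_val_zero, Matrix.cons_val_one, Matrix.cons_val]
  -- identify / bound the three integrals
  have i0 : (∫⁻ x, F 0 x) ^ P 0 = (∫⁻ x, ‖fderiv ℝ z x‖ₑ ^ 2) ^ (1 / 2 : ℝ) := by
    simp only [hF, hP, Matrix.cons_val_zero, hf1, ENNReal.rpow_two]
  have hDz_lt : eLpNorm (fderiv ℝ z) 2 volume < ⊤ := by
    rw [eLpNorm_lt_top_iff_lintegral_rpow_enorm_lt_top two_ne_zero ENNReal.ofNat_ne_top]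
    simpa [ENNReal.rpow_two] using hDz2
  have ha_lt : eLpNorm a 2 volume < ⊤ := by
    rw [eLpNorm_lt_top_iff_lintegral_rpow_enorm_lt_top two_ne_zero ENNReal.ofNat_ne_top]
    simpa [ENNReal.rpow_two] using ha2
  have i1 : (∫⁻ x, F 1 x) ^ P 1 ≤ K₂ * (∫⁻ x, ‖iteratedFDeriv ℝ 2 z x‖ₑ ^ 2) ^ (1 / 2 : ℝ) := by
    simp only [hF, hP, Matrix.cons_val_one, Matrix.cons_val_zero]
    have hS := eLpNorm_six_le_eLpNorm_fderiv_two volume hE hDz1 hDz_lt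
    have e6 : eLpNorm (fderiv ℝ z) 6 volume = (∫⁻ x, f2 x) ^ (1 / 6 : ℝ) := by
      rw [eLpNorm_eq_lintegral_rpow_enorm_toReal (by norm_num) (ENNReal.ofNat_ne_top (n := 6))]
      simp [hf2]
    have e2 : eLpNorm (fderiv ℝ (fderiv ℝ z)) 2 volume =
        (∫⁻ x, ‖iteratedFDeriv ℝ 2 z x‖ₑ ^ 2) ^ (1 / 2 : ℝ) := by
      rw [eLpNorm_eq_lintegral_rpow_enorm_toReal two_ne_zero ENNReal.ofNat_ne_top]
      simp only [ENNReal.toReal_ofNat, ENNReal.rpow_two, one_div]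
      congr 1
      refine lintegral_congr fun x => ?_
      rw [← ofReal_norm, ← ofReal_norm, ← norm_iteratedFDeriv_fderiv, norm_iteratedFDeriv_one]
    rw [← e6, ← e2]
    exact hS
  have i2 : (∫⁻ x, F 2 x) ^ P 2 ≤ K₁ ^ 2 * ∫⁻ x, ‖fderiv ℝ a x‖ₑ ^ 2 := by
    simp only [hF, hP, Matrix.cons_val]
    have hS := eLpNorm_six_le_eLpNorm_fderiv_two volume hE ha ha_lt
    have e6 : eLpNorm a 6 volume = (∫⁻ x, f3 x) ^ (1 / 6 : ℝ) := by
      rw [eLpNorm_eq_lintegral_rpow_enorm_toReal (by norm_num) (ENNReal.ofNat_ne_top (n := 6))]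
      simp [hf3]
    have e2 : eLpNorm (fderiv ℝ a) 2 volume = (∫⁻ x, ‖fderiv ℝ a x‖ₑ ^ 2) ^ (1 / 2 : ℝ) := by
      rw [eLpNorm_eq_lintegral_rpow_enorm_toReal two_ne_zero ENNReal.ofNat_ne_top]
      simp
    have h13 : (∫⁻ x, f3 x) ^ (1 / 3 : ℝ) = ((∫⁻ x, f3 x) ^ (1 / 6 : ℝ)) ^ (2 : ℝ) := by
      rw [← ENNReal.rpow_mul]; norm_num
    rw [h13, ← e6]
    calc eLpNorm a 6 volume ^ (2 : ℝ) ≤ (K₁ * eLpNorm (fderiv ℝ a) 2 volume) ^ (2 : ℝ) := by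
          gcongr
      _ = K₁ ^ 2 * ∫⁻ x, ‖fderiv ℝ a x‖ₑ ^ 2 := by
          rw [ENNReal.mul_rpow_of_nonneg _ _ (by norm_num), e2, ← ENNReal.rpow_mul]
          norm_num
  calc ∫⁻ x, ‖fderiv ℝ z x (a x)‖ₑ ^ 2 ≤ ∫⁻ x, F 0 x ^ P 0 * F 1 x ^ P 1 * F 2 x ^ P 2 :=
        lintegral_mono hpt
    _ ≤ (∫⁻ x, F 0 x) ^ P 0 * (∫⁻ x, F 1 x) ^ P 1 * (∫⁻ x, F 2 x) ^ P 2 := hH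
    _ ≤ (∫⁻ x, ‖fderiv ℝ z x‖ₑ ^ 2) ^ (1 / 2 : ℝ) *
          (K₂ * (∫⁻ x, ‖iteratedFDeriv ℝ 2 z x‖ₑ ^ 2) ^ (1 / 2 : ℝ)) *
          (K₁ ^ 2 * ∫⁻ x, ‖fderiv ℝ a x‖ₑ ^ 2) := by rw [i0]; gcongr
    _ = ↑(K₂ * K₁ ^ 2) * ((∫⁻ x, ‖fderiv ℝ z x‖ₑ ^ 2) ^ (1 / 2 : ℝ) *
          (∫⁻ x, ‖iteratedFDeriv ℝ 2 z x‖ₑ ^ 2) ^ (1 / 2 : ℝ) * ∫⁻ x, ‖fderiv ℝ a x‖ₑ ^ 2) := by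
        push_cast; ring

/-! ### Elementary `ℝ≥0∞` bounds -/

/-- `|L|² ≤ 3 ‖L‖²` on `ℝ³` (Frobenius vs operator), `ℝ≥0∞` form. [folklore] -/
theorem ofReal_frobeniusNormSq_le (L : EuclideanSpace ℝ (Fin 3) →L[ℝ] EuclideanSpace ℝ (Fin 3)) :
    ENNReal.ofReal (frobeniusNormSq L) ≤ 3 * ‖L‖ₑ ^ 2 := by
  have h : frobeniusNormSq L ≤ 3 * ‖L‖ ^ 2 := by
    rw [frobeniusNormSq_eq_sum (EuclideanSpace.basisFun (Fin 3) ℝ)]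
    calc ∑ i, ‖L (EuclideanSpace.basisFun (Fin 3) ℝ i)‖ ^ 2 ≤ ∑ _i : Fin 3, ‖L‖ ^ 2 :=
          Finset.sum_le_sum fun i _ => by
            refine pow_le_pow_left₀ (norm_nonneg _) ?_ 2
            calc ‖L (EuclideanSpace.basisFun (Fin 3) ℝ i)‖ ≤ ‖L‖ * ‖EuclideanSpace.basisFun (Fin 3) ℝ i‖ :=
                  L.le_opNorm _
              _ = ‖L‖ := by rw [(EuclideanSpace.basisFun (Fin 3) ℝ).norm_eq_one, mul_one]
      _ = 3 * ‖L‖ ^ 2 := by simp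
  calc ENNReal.ofReal (frobeniusNormSq L) ≤ ENNReal.ofReal (3 * ‖L‖ ^ 2) := ENNReal.ofReal_le_ofReal h
    _ = 3 * ‖L‖ₑ ^ 2 := by
        rw [ENNReal.ofReal_mul (by norm_num), ENNReal.ofReal_pow (norm_nonneg _), ofReal_norm,
          ENNReal.ofReal_ofNat]

/-- `∫ |curl v|² ≤ κ² ∫ ‖Dv‖²`, `κ = ‖curlCLM‖`. [folklore] -/
theorem lintegral_enorm_curl_sq_le (v : EuclideanSpace ℝ (Fin 3) → EuclideanSpace ℝ (Fin 3)) :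
    ∫⁻ x, ‖curl v x‖ₑ ^ 2 ≤ ENNReal.ofReal (‖curlCLM‖ ^ 2) * ∫⁻ x, ‖fderiv ℝ v x‖ₑ ^ 2 := by
  simpa only [FluidPDE.enorm_iteratedFDeriv_one] using FluidPDE.lintegral_curl_sq_le v


/-- Divergence-free `C¹` fields are closed under differences (with only differentiability this is
`fderiv_sub` and linearity of the trace); used through dot notation (`hda.sub …`) for the pair of
*arbitrary* fields in `exists_lintegral_transport_sq_le`, where the solution-level
`IsClassicalNSSolutionOn.isDivFree_sub` of `NSVorticityDifference.lean` does not apply. [folklore] -/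
theorem VectorCalculus.IsDivFree.sub {E : Type*} [NormedAddCommGroup E] [InnerProductSpace ℝ E]
    [FiniteDimensional ℝ E] {a b : E → E} (hda : VectorCalculus.IsDivFree a) (ha : Differentiable ℝ a)
    (hb : Differentiable ℝ b) (hdb : VectorCalculus.IsDivFree b) : VectorCalculus.IsDivFree (a - b) := by
  intro x
  have h1 := hda x
  have h2 := hdb x
  simp only [VectorCalculus.divergence] at h1 h2 ⊢
  rw [fderiv_sub (ha x) (hb x)]
  simp [map_sub, h1, h2]

/-- `∫ ‖a - b‖² ≤ 2∫‖a‖² + 2∫‖b‖²` for continuous fields (so that the right side splits). [folklore] -/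
theorem lintegral_enorm_sub_sq_le {F : Type*} [NormedAddCommGroup F] {a b : EuclideanSpace ℝ (Fin 3) → F}
    (ha : Continuous a) :
    ∫⁻ x, ‖a x - b x‖ₑ ^ 2 ≤ 2 * (∫⁻ x, ‖a x‖ₑ ^ 2) + 2 * ∫⁻ x, ‖b x‖ₑ ^ 2 := by
  have hm : Measurable fun x => 2 * ‖a x‖ₑ ^ 2 :=
    ((continuous_enorm.comp ha).measurable.pow_const 2).const_mul 2
  calc ∫⁻ x, ‖a x - b x‖ₑ ^ 2 ≤ ∫⁻ x, 2 * ‖a x‖ₑ ^ 2 + 2 * ‖b x‖ₑ ^ 2 :=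
        lintegral_mono fun x => FluidPDE.enorm_sub_sq_le _ _
    _ = 2 * (∫⁻ x, ‖a x‖ₑ ^ 2) + 2 * ∫⁻ x, ‖b x‖ₑ ^ 2 := by
        rw [lintegral_add_left hm, lintegral_const_mul' _ _ ENNReal.ofNat_ne_top,
          lintegral_const_mul' _ _ ENNReal.ofNat_ne_top]

/-- **The `L²` bound of the transport term of the difference equation**: there is an absolute
`C` such that for smooth divergence-free `a, b ∈ L²(ℝ³)` with `∫‖Da‖² ≤ A < ∞`, `∫‖Db‖² ≤ B < ∞`,
and `w = a − b`,
`‖(a·∇)w + (w·∇)b‖²_{L²} ≤ C (A ‖curl w‖_{L²} ‖∇curl w‖_{L²} + B^{1/2} ‖D²b‖_{L²} ‖curl w‖²_{L²})`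
(the convective bound `exists_lintegral_enorm_fderiv_apply_sq_le` for each summand, then the
`div`–`curl` estimates `‖Dw‖²_{L²} ≤ K‖curl w‖²`, `‖D²w‖²_{L²} ≤ K‖∇ curl w‖²` of
`NS.tao2011_sobolev_of_vorticity_holds`; Majda–Bertozzi §3.2). [folklore] -/
theorem exists_lintegral_transport_sq_le :
    ∃ C : ℝ≥0, ∀ (a b : EuclideanSpace ℝ (Fin 3) → EuclideanSpace ℝ (Fin 3)), ContDiff ℝ ∞ a → ContDiff ℝ ∞ b → VectorCalculus.IsDivFree a → VectorCalculus.IsDivFree b →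
      ∫⁻ x, ‖a x‖ₑ ^ 2 < ⊤ → ∫⁻ x, ‖b x‖ₑ ^ 2 < ⊤ →
      ∀ (A B : ℝ≥0∞), A ≠ ⊤ → B ≠ ⊤ →
      ∫⁻ x, ‖fderiv ℝ a x‖ₑ ^ 2 ≤ A → ∫⁻ x, ‖fderiv ℝ b x‖ₑ ^ 2 ≤ B →
      ∫⁻ x, ‖fderiv ℝ (a - b) x (a x) + fderiv ℝ b x ((a - b) x)‖ₑ ^ 2 ≤
        C * (A * (∫⁻ x, ‖curl (a - b) x‖ₑ ^ 2) ^ (1 / 2 : ℝ) *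
              (∫⁻ x, ENNReal.ofReal (frobeniusNormSq (fderiv ℝ (curl (a - b)) x))) ^ (1 / 2 : ℝ)
            + B ^ (1 / 2 : ℝ) * (∫⁻ x, ‖iteratedFDeriv ℝ 2 b x‖ₑ ^ 2) ^ (1 / 2 : ℝ) *
              ∫⁻ x, ‖curl (a - b) x‖ₑ ^ 2) := by
  obtain ⟨C₀, hC₀⟩ := exists_lintegral_enorm_fderiv_apply_sq_le
  obtain ⟨K, hK⟩ := FluidPDE.tao2011_sobolev_of_vorticity_holds
  refine ⟨2 * C₀ * K, fun a b ha hb hda hdb ha2 hb2 A B hA hB hDa hDb => ?_⟩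
  set w : EuclideanSpace ℝ (Fin 3) → EuclideanSpace ℝ (Fin 3) := a - b with hwdef
  set Ω : ℝ≥0∞ := ∫⁻ x, ‖curl w x‖ₑ ^ 2 with hΩ
  set P : ℝ≥0∞ := ∫⁻ x, ENNReal.ofReal (frobeniusNormSq (fderiv ℝ (curl w) x)) with hP
  set Db : ℝ≥0∞ := (∫⁻ x, ‖iteratedFDeriv ℝ 2 b x‖ₑ ^ 2) ^ (1 / 2 : ℝ) with hDbdef
  have h2top : (2 : ℝ≥0∞) < ⊤ := ENNReal.ofNat_lt_top
  have ha1 : ContDiff ℝ 1 a := ha.of_le (by norm_cast)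
  have hb1 : ContDiff ℝ 1 b := hb.of_le (by norm_cast)
  have hb2' : ContDiff ℝ 2 b := hb.of_le (by norm_cast)
  have hw : ContDiff ℝ ∞ w := ha.sub hb
  have hw1 : ContDiff ℝ 1 w := hw.of_le (by norm_cast)
  have hw2 : ContDiff ℝ 2 w := hw.of_le (by norm_cast)
  have hwdiv : VectorCalculus.IsDivFree w :=
    hda.sub (ha1.differentiable one_ne_zero) (hb1.differentiable one_ne_zero) hdb
  -- `w ∈ L²`, `Dw ∈ L²`
  have hwL2 : ∫⁻ x, ‖w x‖ₑ ^ 2 < ⊤ := by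
    calc ∫⁻ x, ‖w x‖ₑ ^ 2 = ∫⁻ x, ‖a x - b x‖ₑ ^ 2 := rfl
      _ ≤ 2 * (∫⁻ x, ‖a x‖ₑ ^ 2) + 2 * ∫⁻ x, ‖b x‖ₑ ^ 2 := lintegral_enorm_sub_sq_le ha.continuous
      _ < ⊤ := ENNReal.add_lt_top.2 ⟨ENNReal.mul_lt_top h2top ha2, ENNReal.mul_lt_top h2top hb2⟩
  have hDw_le : ∫⁻ x, ‖fderiv ℝ w x‖ₑ ^ 2 ≤ 2 * A + 2 * B := by
    calc ∫⁻ x, ‖fderiv ℝ w x‖ₑ ^ 2 = ∫⁻ x, ‖fderiv ℝ a x - fderiv ℝ b x‖ₑ ^ 2 := by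
          refine lintegral_congr fun x => ?_
          rw [hwdef, fderiv_sub (ha1.differentiable one_ne_zero x) (hb1.differentiable one_ne_zero x)]
      _ ≤ 2 * (∫⁻ x, ‖fderiv ℝ a x‖ₑ ^ 2) + 2 * ∫⁻ x, ‖fderiv ℝ b x‖ₑ ^ 2 :=
          lintegral_enorm_sub_sq_le (ha1.continuous_fderiv one_ne_zero)
      _ ≤ 2 * A + 2 * B := by gcongr
  have hDw_lt : ∫⁻ x, ‖fderiv ℝ w x‖ₑ ^ 2 < ⊤ :=
    hDw_le.trans_lt (ENNReal.add_lt_top.2 ⟨ENNReal.mul_lt_top h2top hA.lt_top,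
      ENNReal.mul_lt_top h2top hB.lt_top⟩)
  have hDb_lt : ∫⁻ x, ‖fderiv ℝ b x‖ₑ ^ 2 < ⊤ := hDb.trans_lt hB.lt_top
  -- the `div`–`curl` estimates for `w`
  obtain ⟨hK1, hK2⟩ := hK hw hwdiv hwL2
  have hK1' : ∫⁻ x, ‖fderiv ℝ w x‖ₑ ^ 2 ≤ K * Ω := by
    simpa only [FluidPDE.enorm_iteratedFDeriv_one] using hK1
  have hK2' : ∫⁻ x, ‖iteratedFDeriv ℝ 2 w x‖ₑ ^ 2 ≤ K * P :=
    hK2.trans (by gcongr; exact lintegral_mono fun x => sq_enorm_le_ofReal_frobeniusNormSq _)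
  have hKK : (K : ℝ≥0∞) ^ (1 / 2 : ℝ) * (K : ℝ≥0∞) ^ (1 / 2 : ℝ) = K := by
    rw [← ENNReal.rpow_add_of_nonneg _ _ (by norm_num) (by norm_num)]; norm_num
  -- the two transport terms
  have h1 : ∫⁻ x, ‖fderiv ℝ w x (a x)‖ₑ ^ 2 ≤ C₀ * (K * Ω ^ (1 / 2 : ℝ) * P ^ (1 / 2 : ℝ) * A) := by
    calc ∫⁻ x, ‖fderiv ℝ w x (a x)‖ₑ ^ 2
        ≤ C₀ * ((∫⁻ x, ‖fderiv ℝ w x‖ₑ ^ 2) ^ (1 / 2 : ℝ) *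
            (∫⁻ x, ‖iteratedFDeriv ℝ 2 w x‖ₑ ^ 2) ^ (1 / 2 : ℝ) * ∫⁻ x, ‖fderiv ℝ a x‖ₑ ^ 2) :=
          hC₀ a w ha1 hw2 ha2 hDw_lt
      _ ≤ C₀ * ((K * Ω) ^ (1 / 2 : ℝ) * (K * P) ^ (1 / 2 : ℝ) * A) := by gcongr
      _ = C₀ * (K * Ω ^ (1 / 2 : ℝ) * P ^ (1 / 2 : ℝ) * A) := by
          rw [ENNReal.mul_rpow_of_nonneg _ _ (by norm_num), ENNReal.mul_rpow_of_nonneg _ _ (by norm_num)]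
          calc (C₀ : ℝ≥0∞) * ((K : ℝ≥0∞) ^ (1 / 2 : ℝ) * Ω ^ (1 / 2 : ℝ) *
                ((K : ℝ≥0∞) ^ (1 / 2 : ℝ) * P ^ (1 / 2 : ℝ)) * A)
              = C₀ * (((K : ℝ≥0∞) ^ (1 / 2 : ℝ) * (K : ℝ≥0∞) ^ (1 / 2 : ℝ)) * Ω ^ (1 / 2 : ℝ) *
                  P ^ (1 / 2 : ℝ) * A) := by ring
            _ = _ := by rw [hKK]
  have h2 : ∫⁻ x, ‖fderiv ℝ b x (w x)‖ₑ ^ 2 ≤ C₀ * (B ^ (1 / 2 : ℝ) * Db * (K * Ω)) := by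
    calc ∫⁻ x, ‖fderiv ℝ b x (w x)‖ₑ ^ 2
        ≤ C₀ * ((∫⁻ x, ‖fderiv ℝ b x‖ₑ ^ 2) ^ (1 / 2 : ℝ) *
            (∫⁻ x, ‖iteratedFDeriv ℝ 2 b x‖ₑ ^ 2) ^ (1 / 2 : ℝ) * ∫⁻ x, ‖fderiv ℝ w x‖ₑ ^ 2) :=
          hC₀ w b hw1 hb2' hwL2 hDb_lt
      _ ≤ C₀ * (B ^ (1 / 2 : ℝ) * Db * (K * Ω)) := by rw [hDbdef]; gcongr
  -- assemble
  have hm : Measurable fun x => 2 * ‖fderiv ℝ w x (a x)‖ₑ ^ 2 :=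
    ((continuous_enorm.comp ((hw1.continuous_fderiv one_ne_zero).clm_apply
      ha.continuous)).measurable.pow_const 2).const_mul 2
  calc ∫⁻ x, ‖fderiv ℝ w x (a x) + fderiv ℝ b x (w x)‖ₑ ^ 2
      ≤ ∫⁻ x, 2 * ‖fderiv ℝ w x (a x)‖ₑ ^ 2 + 2 * ‖fderiv ℝ b x (w x)‖ₑ ^ 2 :=
        lintegral_mono fun x => by
          -- `‖y + z‖ₑ² ≤ 2‖y‖ₑ² + 2‖z‖ₑ²` from the tree's `NS.enorm_sub_sq_le`
          simpa [sub_neg_eq_add] using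
            FluidPDE.enorm_sub_sq_le (fderiv ℝ w x (a x)) (-(fderiv ℝ b x (w x)))
    _ = 2 * (∫⁻ x, ‖fderiv ℝ w x (a x)‖ₑ ^ 2) + 2 * ∫⁻ x, ‖fderiv ℝ b x (w x)‖ₑ ^ 2 := by
        rw [lintegral_add_left hm, lintegral_const_mul' _ _ ENNReal.ofNat_ne_top,
          lintegral_const_mul' _ _ ENNReal.ofNat_ne_top]
    _ ≤ 2 * (C₀ * (K * Ω ^ (1 / 2 : ℝ) * P ^ (1 / 2 : ℝ) * A)) +
          2 * (C₀ * (B ^ (1 / 2 : ℝ) * Db * (K * Ω))) := by gcongr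
    _ = ↑(2 * C₀ * K) * (A * Ω ^ (1 / 2 : ℝ) * P ^ (1 / 2 : ℝ) + B ^ (1 / 2 : ℝ) * Db * Ω) := by
        push_cast; ring


/-! ### `ℝ≥0∞` square-root helpers -/

/-- `x^{1/2} ≤ 1 + x` in `ℝ≥0∞`. [folklore] -/
theorem ennreal_rpow_half_le_one_add (x : ℝ≥0∞) : x ^ (1 / 2 : ℝ) ≤ 1 + x := by
  rcases le_total x 1 with h | h
  · exact (ENNReal.rpow_le_one h (by norm_num)).trans le_self_add
  · calc x ^ (1 / 2 : ℝ) ≤ x ^ (1 : ℝ) := ENNReal.rpow_le_rpow_of_exponent_le h (by norm_num)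
      _ = x := ENNReal.rpow_one x
      _ ≤ 1 + x := le_add_self

/-- `x^{1/2} y^{1/2} ≤ x + y` in `ℝ≥0∞` (crude AM–GM). [folklore] -/
theorem ennreal_rpow_half_mul_rpow_half_le (x y : ℝ≥0∞) :
    x ^ (1 / 2 : ℝ) * y ^ (1 / 2 : ℝ) ≤ x + y := by
  -- `(z^{1/2})² = z` is Mathlib's `ENNReal.rpow_inv_natCast_pow`
  have h : ∀ z : ℝ≥0∞, (z ^ (1 / 2 : ℝ)) ^ 2 = z := fun z => by
    simpa [one_div] using ENNReal.rpow_inv_natCast_pow two_ne_zero z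
  calc x ^ (1 / 2 : ℝ) * y ^ (1 / 2 : ℝ) ≤ (x ^ (1 / 2 : ℝ)) ^ 2 + (y ^ (1 / 2 : ℝ)) ^ 2 :=
        ennreal_mul_le_sq_add_sq _ _
    _ = x + y := by rw [h, h]

/-- Young's inequality with square roots: `U a^{1/2} b^{1/2} ≤ ε b + K U² a`. [folklore] -/
theorem exists_young_half {ε : ℝ≥0∞} (hε0 : ε ≠ 0) (hε : ε ≠ ⊤) :
    ∃ K : ℝ≥0∞, K ≠ ⊤ ∧ ∀ U a b : ℝ≥0∞,
      U * a ^ (1 / 2 : ℝ) * b ^ (1 / 2 : ℝ) ≤ ε * b + K * U ^ 2 * a := by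
  obtain ⟨K, hK, h⟩ := FluidPDE.young_absorb le_rfl zero_lt_one 1 hε0 hε
  refine ⟨K, hK, fun U a b => ?_⟩
  have := h U a b
  norm_num at this
  simpa [ENNReal.rpow_two] using this

/-- Cauchy–Schwarz for lower integrals. [folklore] -/
theorem lintegral_mul_le_sqrt_mul_sqrt {f g : EuclideanSpace ℝ (Fin 3) → ℝ≥0∞} (hf : AEMeasurable f volume)
    (hg : AEMeasurable g volume) :
    ∫⁻ x, f x * g x ≤ (∫⁻ x, f x ^ 2) ^ (1 / 2 : ℝ) * (∫⁻ x, g x ^ 2) ^ (1 / 2 : ℝ) := by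
  have h := ENNReal.lintegral_mul_le_Lp_mul_Lq volume Real.HolderConjugate.two_two hf hg
  simpa only [Pi.mul_apply, ENNReal.rpow_two] using h

/-- `‖D⁰f(x)‖ₑ = ‖f x‖ₑ`. [folklore] -/
theorem enorm_iteratedFDeriv_zero_eq {E F : Type*} [NormedAddCommGroup E] [NormedSpace ℝ E]
    [NormedAddCommGroup F] [NormedSpace ℝ F] (f : E → F) (x : E) :
    ‖iteratedFDeriv ℝ 0 f x‖ₑ = ‖f x‖ₑ := by
  rw [← ofReal_norm, ← ofReal_norm, norm_iteratedFDeriv_zero]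

/-! ### A priori bounds for the difference of two `X¹` fields -/

section APriori

variable {T ν : ℝ} {f u v : ℝ → EuclideanSpace ℝ (Fin 3) → EuclideanSpace ℝ (Fin 3)} {p q : ℝ → EuclideanSpace ℝ (Fin 3) → ℝ}

/-- Measurability in time of `τ ↦ ∫ ‖Dⁿ(u τ)‖²`. [folklore] -/
theorem IsSmoothSpaceTimeOn.aemeasurable_lintegral_iteratedFDeriv_sq
    (hu : IsSmoothSpaceTimeOn (Icc 0 T) u) (hT : 0 < T) (n : ℕ) {T' : ℝ} (hT' : T' ≤ T) :
    AEMeasurable (fun τ => ∫⁻ x, ‖iteratedFDeriv ℝ n (u τ) x‖ₑ ^ 2)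
      ((volume : Measure ℝ).restrict (Ioo 0 T')) := by
  have hc : ContinuousOn (fun z : ℝ × EuclideanSpace ℝ (Fin 3) => iteratedFDeriv ℝ n (u z.1) z.2) (Icc 0 T' ×ˢ univ) :=
    (hu.iteratedFDeriv_slice (uniqueDiffOn_Icc hT) n).continuousOn.mono
      (prod_mono (Icc_subset_Icc le_rfl hT') Subset.rfl)
  exact ((aestronglyMeasurable_prod_of_continuousOn hc).enorm.pow_const 2).lintegral_prod_right'

/-- Measurability in time of the dissipation `τ ↦ ∫ |∇ curl w(τ)|²` of the difference. [folklore] -/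
theorem IsSmoothSpaceTimeOn.aemeasurable_dissipation_sub
    (hu : IsSmoothSpaceTimeOn (Icc 0 T) u) (hv : IsSmoothSpaceTimeOn (Icc 0 T) v) (hT : 0 < T)
    {T' : ℝ} (hT' : T' ≤ T) :
    AEMeasurable (fun τ => ∫⁻ x, ENNReal.ofReal (frobeniusNormSq (fderiv ℝ (curl ((u - v) τ)) x)))
      ((volume : Measure ℝ).restrict (Ioo 0 T')) := by
  have hU : UniqueDiffOn ℝ (Icc 0 T) := uniqueDiffOn_Icc hT
  have hw : IsSmoothSpaceTimeOn (Icc 0 T) (u - v) := hu.sub hv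
  have hWs : IsSmoothSpaceTimeOn (Icc 0 T) (fun τ x => curl ((u - v) τ) x) :=
    (hw.fderiv_slice hU).clm curlCLM
  have hc : ContinuousOn (fun z : ℝ × EuclideanSpace ℝ (Fin 3) => fderiv ℝ (curl ((u - v) z.1)) z.2) (Icc 0 T' ×ˢ univ) :=
    (hWs.fderiv_slice hU).continuousOn.mono (prod_mono (Icc_subset_Icc le_rfl hT') Subset.rfl)
  exact (ENNReal.measurable_ofReal.comp_aemeasurable
    (NSWeakStrongUniqueness.continuous_frobeniusNormSq.comp_aestronglyMeasurable
      (aestronglyMeasurable_prod_of_continuousOn hc)).aemeasurable).lintegral_prod_right'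

/-- **Uniform enstrophy bound of the difference**: `sup_τ ∫ |curl w(τ)|² < ∞`. [folklore] -/
theorem exists_lintegral_curl_sub_sq_le (hu : IsSmoothSpaceTimeOn (Icc 0 T) u)
    (hv : IsSmoothSpaceTimeOn (Icc 0 T) v) (hXu : FluidPDE.MemSobolevX 1 T u) (hXv : FluidPDE.MemSobolevX 1 T v) :
    ∃ M : ℝ≥0∞, M ≠ ⊤ ∧ ∀ τ ∈ Icc 0 T, ∫⁻ x, ‖curl ((u - v) τ) x‖ₑ ^ 2 ≤ M := by
  obtain ⟨A, hA⟩ := hXu.exists_bound le_rfl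
  obtain ⟨B, hB⟩ := hXv.exists_bound le_rfl
  refine ⟨ENNReal.ofReal (‖curlCLM‖ ^ 2) * (2 * A + 2 * B),
    ENNReal.mul_ne_top ENNReal.ofReal_ne_top (ENNReal.add_ne_top.2
      ⟨ENNReal.mul_ne_top ENNReal.ofNat_ne_top ENNReal.coe_ne_top,
        ENNReal.mul_ne_top ENNReal.ofNat_ne_top ENNReal.coe_ne_top⟩), fun τ hτ => ?_⟩
  have hu1 : ContDiff ℝ 1 (u τ) := (hu.contDiff_slice hτ).of_le (by norm_cast)
  have hv1 : ContDiff ℝ 1 (v τ) := (hv.contDiff_slice hτ).of_le (by norm_cast)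
  calc ∫⁻ x, ‖curl ((u - v) τ) x‖ₑ ^ 2
      ≤ ENNReal.ofReal (‖curlCLM‖ ^ 2) * ∫⁻ x, ‖fderiv ℝ ((u - v) τ) x‖ₑ ^ 2 :=
        lintegral_enorm_curl_sq_le _
    _ ≤ ENNReal.ofReal (‖curlCLM‖ ^ 2) * (2 * A + 2 * B) := by
        gcongr
        calc ∫⁻ x, ‖fderiv ℝ ((u - v) τ) x‖ₑ ^ 2
            = ∫⁻ x, ‖fderiv ℝ (u τ) x - fderiv ℝ (v τ) x‖ₑ ^ 2 := by
              refine lintegral_congr fun x => ?_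
              rw [Pi.sub_apply, fderiv_sub (hu1.differentiable one_ne_zero x)
                (hv1.differentiable one_ne_zero x)]
          _ ≤ 2 * (∫⁻ x, ‖fderiv ℝ (u τ) x‖ₑ ^ 2) + 2 * ∫⁻ x, ‖fderiv ℝ (v τ) x‖ₑ ^ 2 :=
              lintegral_enorm_sub_sq_le (hu1.continuous_fderiv one_ne_zero)
          _ ≤ 2 * A + 2 * B := by
              gcongr
              · simpa only [FluidPDE.enorm_iteratedFDeriv_one] using hA τ hτ
              · simpa only [FluidPDE.enorm_iteratedFDeriv_one] using hB τ hτ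

/-- `∫ |∇ curl w|²_F ≤ 3κ² ∫ ‖D²w‖²`. [folklore] -/
theorem lintegral_ofReal_frobeniusNormSq_fderiv_curl_le {w : EuclideanSpace ℝ (Fin 3) → EuclideanSpace ℝ (Fin 3)} (hw : ContDiff ℝ 2 w) :
    ∫⁻ x, ENNReal.ofReal (frobeniusNormSq (fderiv ℝ (curl w) x)) ≤
      3 * ENNReal.ofReal (‖curlCLM‖ ^ 2) * ∫⁻ x, ‖iteratedFDeriv ℝ 2 w x‖ₑ ^ 2 := by
  have h3 : (3 : ℝ≥0∞) * ENNReal.ofReal (‖curlCLM‖ ^ 2) ≠ ⊤ :=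
    ENNReal.mul_ne_top ENNReal.ofNat_ne_top ENNReal.ofReal_ne_top
  rw [← lintegral_const_mul' _ _ h3]
  refine lintegral_mono fun x => ?_
  calc ENNReal.ofReal (frobeniusNormSq (fderiv ℝ (curl w) x)) ≤ 3 * ‖fderiv ℝ (curl w) x‖ₑ ^ 2 :=
        ofReal_frobeniusNormSq_le _
    _ ≤ 3 * (ENNReal.ofReal (‖curlCLM‖ ^ 2) * ‖iteratedFDeriv ℝ 2 w x‖ₑ ^ 2) := by
        gcongr
        rw [← ofReal_norm, ← ofReal_norm, ← ENNReal.ofReal_pow (norm_nonneg _),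
          ← ENNReal.ofReal_pow (norm_nonneg _), ← ENNReal.ofReal_mul (sq_nonneg _), ← mul_pow]
        exact ENNReal.ofReal_le_ofReal
          (pow_le_pow_left₀ (norm_nonneg _) (norm_fderiv_curl_le hw x) 2)
    _ = 3 * ENNReal.ofReal (‖curlCLM‖ ^ 2) * ‖iteratedFDeriv ℝ 2 w x‖ₑ ^ 2 := (mul_assoc _ _ _).symm

/-- **Finite dissipation of the difference**: `∫₀ᵀ ∫ |∇ curl w|² < ∞` from `u, v ∈ L²_t H²_x`. [folklore] -/
theorem lintegral_dissipation_sub_lt_top (hu : IsSmoothSpaceTimeOn (Icc 0 T) u)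
    (hv : IsSmoothSpaceTimeOn (Icc 0 T) v) (hXu : FluidPDE.MemSobolevX 1 T u) (hXv : FluidPDE.MemSobolevX 1 T v)
    (hT : 0 < T) :
    ∫⁻ τ in Ioo 0 T, ∫⁻ x, ENNReal.ofReal (frobeniusNormSq (fderiv ℝ (curl ((u - v) τ)) x)) < ⊤ := by
  set κ₃ : ℝ≥0∞ := 3 * ENNReal.ofReal (‖curlCLM‖ ^ 2) with hκ₃
  have hκ₃ne : κ₃ ≠ ⊤ := ENNReal.mul_ne_top ENNReal.ofNat_ne_top ENNReal.ofReal_ne_top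
  have h2u : ∫⁻ τ in Ioo 0 T, ∫⁻ x, ‖iteratedFDeriv ℝ 2 (u τ) x‖ₑ ^ 2 < ⊤ := hXu.2
  have h2v : ∫⁻ τ in Ioo 0 T, ∫⁻ x, ‖iteratedFDeriv ℝ 2 (v τ) x‖ₑ ^ 2 < ⊤ := hXv.2
  have mU := hu.aemeasurable_lintegral_iteratedFDeriv_sq hT 2 le_rfl
  have hpt : ∀ τ ∈ Ioo 0 T,
      ∫⁻ x, ENNReal.ofReal (frobeniusNormSq (fderiv ℝ (curl ((u - v) τ)) x)) ≤
        κ₃ * (2 * (∫⁻ x, ‖iteratedFDeriv ℝ 2 (u τ) x‖ₑ ^ 2) +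
          2 * ∫⁻ x, ‖iteratedFDeriv ℝ 2 (v τ) x‖ₑ ^ 2) := by
    intro τ hτ
    have hτ' : τ ∈ Icc 0 T := Ioo_subset_Icc_self hτ
    have hu2 : ContDiff ℝ 2 (u τ) := (hu.contDiff_slice hτ').of_le (by norm_cast)
    have hv2 : ContDiff ℝ 2 (v τ) := (hv.contDiff_slice hτ').of_le (by norm_cast)
    calc ∫⁻ x, ENNReal.ofReal (frobeniusNormSq (fderiv ℝ (curl ((u - v) τ)) x))
        ≤ κ₃ * ∫⁻ x, ‖iteratedFDeriv ℝ 2 ((u - v) τ) x‖ₑ ^ 2 :=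
          lintegral_ofReal_frobeniusNormSq_fderiv_curl_le (hu2.sub hv2)
      _ ≤ κ₃ * (2 * (∫⁻ x, ‖iteratedFDeriv ℝ 2 (u τ) x‖ₑ ^ 2) +
            2 * ∫⁻ x, ‖iteratedFDeriv ℝ 2 (v τ) x‖ₑ ^ 2) := by
          gcongr
          calc ∫⁻ x, ‖iteratedFDeriv ℝ 2 ((u - v) τ) x‖ₑ ^ 2
              = ∫⁻ x, ‖iteratedFDeriv ℝ 2 (u τ) x - iteratedFDeriv ℝ 2 (v τ) x‖ₑ ^ 2 := by
                refine lintegral_congr fun x => ?_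
                rw [Pi.sub_apply, iteratedFDeriv_sub_apply hu2.contDiffAt hv2.contDiffAt]
            _ ≤ _ := lintegral_enorm_sub_sq_le (hu2.continuous_iteratedFDeriv le_rfl)
  calc ∫⁻ τ in Ioo 0 T, ∫⁻ x, ENNReal.ofReal (frobeniusNormSq (fderiv ℝ (curl ((u - v) τ)) x))
      ≤ ∫⁻ τ in Ioo 0 T, κ₃ * (2 * (∫⁻ x, ‖iteratedFDeriv ℝ 2 (u τ) x‖ₑ ^ 2) +
          2 * ∫⁻ x, ‖iteratedFDeriv ℝ 2 (v τ) x‖ₑ ^ 2) := setLIntegral_mono' measurableSet_Ioo hpt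
    _ = κ₃ * (2 * (∫⁻ τ in Ioo 0 T, ∫⁻ x, ‖iteratedFDeriv ℝ 2 (u τ) x‖ₑ ^ 2) +
          2 * ∫⁻ τ in Ioo 0 T, ∫⁻ x, ‖iteratedFDeriv ℝ 2 (v τ) x‖ₑ ^ 2) := by
        rw [lintegral_const_mul' _ _ hκ₃ne, lintegral_add_left' (mU.const_mul _),
          lintegral_const_mul' _ _ ENNReal.ofNat_ne_top,
          lintegral_const_mul' _ _ ENNReal.ofNat_ne_top]
    _ < ⊤ := ENNReal.mul_lt_top hκ₃ne.lt_top (ENNReal.add_lt_top.2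
        ⟨ENNReal.mul_lt_top ENNReal.ofNat_lt_top h2u, ENNReal.mul_lt_top ENNReal.ofNat_lt_top h2v⟩)

/-- Slices of an `X¹` field are in `L²`. [folklore] -/
theorem lintegral_enorm_sq_lt_top_of_memSobolevX (hXu : FluidPDE.MemSobolevX 1 T u) {τ : ℝ}
    (hτ : τ ∈ Icc 0 T) : ∫⁻ x, ‖u τ x‖ₑ ^ 2 < ⊤ := by
  obtain ⟨A₀, hA₀⟩ := hXu.exists_bound zero_le_one
  have : ∫⁻ x, ‖u τ x‖ₑ ^ 2 ≤ A₀ := by simpa only [enorm_iteratedFDeriv_zero_eq] using hA₀ τ hτ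
  exact this.trans_lt ENNReal.coe_lt_top

/-- Slices of an `X¹` field have gradient in `L²`, with a uniform bound. [folklore] -/
theorem exists_lintegral_enorm_fderiv_sq_le_of_memSobolevX (hXu : FluidPDE.MemSobolevX 1 T u) :
    ∃ A : ℝ≥0, ∀ τ ∈ Icc 0 T, ∫⁻ x, ‖fderiv ℝ (u τ) x‖ₑ ^ 2 ≤ A := by
  obtain ⟨A, hA⟩ := hXu.exists_bound le_rfl
  exact ⟨A, fun τ hτ => by simpa only [FluidPDE.enorm_iteratedFDeriv_one] using hA τ hτ⟩

/-- **Finite transport of the difference**: `∫₀ᵀ ‖(u·∇)w + (w·∇)v‖²_{L²} < ∞`. [folklore] -/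
theorem IsClassicalNSSolutionOn.lintegral_transport_sub_lt_top
    (hu : IsClassicalNSSolutionOn (Icc 0 T) ν f u p)
    (hv : IsClassicalNSSolutionOn (Icc 0 T) ν f v q)
    (hXu : FluidPDE.MemSobolevX 1 T u) (hXv : FluidPDE.MemSobolevX 1 T v) (hT : 0 < T) :
    ∫⁻ τ in Ioo 0 T, ∫⁻ x,
      ‖convect (u τ) ((u - v) τ) x + convect ((u - v) τ) (v τ) x‖ₑ ^ 2 < ⊤ := by
  obtain ⟨C, hC⟩ := exists_lintegral_transport_sq_le
  obtain ⟨M, hM, hΩM⟩ :=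
    exists_lintegral_curl_sub_sq_le hu.smooth_velocity hv.smooth_velocity hXu hXv
  obtain ⟨A, hA⟩ := exists_lintegral_enorm_fderiv_sq_le_of_memSobolevX hXu
  obtain ⟨B, hB⟩ := exists_lintegral_enorm_fderiv_sq_le_of_memSobolevX hXv
  have hPT := lintegral_dissipation_sub_lt_top hu.smooth_velocity hv.smooth_velocity hXu hXv hT
  have h2v : ∫⁻ τ in Ioo 0 T, ∫⁻ x, ‖iteratedFDeriv ℝ 2 (v τ) x‖ₑ ^ 2 < ⊤ := hXv.2
  have mP := hu.smooth_velocity.aemeasurable_dissipation_sub hv.smooth_velocity hT le_rfl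
  set P : ℝ → ℝ≥0∞ := fun τ =>
    ∫⁻ x, ENNReal.ofReal (frobeniusNormSq (fderiv ℝ (curl ((u - v) τ)) x)) with hPdef
  set D2v : ℝ → ℝ≥0∞ := fun τ => ∫⁻ x, ‖iteratedFDeriv ℝ 2 (v τ) x‖ₑ ^ 2 with hD2vdef
  have hBM : (B : ℝ≥0∞) ^ (1 / 2 : ℝ) * M ≠ ⊤ :=
    ENNReal.mul_ne_top (ENNReal.rpow_ne_top_of_nonneg (by norm_num) ENNReal.coe_ne_top) hM
  -- pointwise bound
  have hpt : ∀ τ ∈ Ioo 0 T,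
      ∫⁻ x, ‖convect (u τ) ((u - v) τ) x + convect ((u - v) τ) (v τ) x‖ₑ ^ 2 ≤
        C * ((A : ℝ≥0∞) * (M + P τ) + (B : ℝ≥0∞) ^ (1 / 2 : ℝ) * M * (1 + D2v τ)) := by
    intro τ hτ
    have hτ' : τ ∈ Icc 0 T := Ioo_subset_Icc_self hτ
    have hΓ := hC (u τ) (v τ) (hu.contDiff_velocity hτ') (hv.contDiff_velocity hτ')
      (hu.divFree τ hτ') (hv.divFree τ hτ') (lintegral_enorm_sq_lt_top_of_memSobolevX hXu hτ')
      (lintegral_enorm_sq_lt_top_of_memSobolevX hXv hτ') A B ENNReal.coe_ne_top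
      ENNReal.coe_ne_top (hA τ hτ') (hB τ hτ')
    refine hΓ.trans ?_
    gcongr C * (?_ + ?_)
    · rw [mul_assoc]
      gcongr
      exact (ennreal_rpow_half_mul_rpow_half_le _ _).trans (add_le_add (hΩM τ hτ') le_rfl)
    · calc (B : ℝ≥0∞) ^ (1 / 2 : ℝ) * (∫⁻ x, ‖iteratedFDeriv ℝ 2 (v τ) x‖ₑ ^ 2) ^ (1 / 2 : ℝ) *
            ∫⁻ x, ‖curl ((u τ - v τ)) x‖ₑ ^ 2
          ≤ (B : ℝ≥0∞) ^ (1 / 2 : ℝ) * (1 + D2v τ) * M := by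
            gcongr
            · exact ennreal_rpow_half_le_one_add _
            · exact hΩM τ hτ'
        _ = (B : ℝ≥0∞) ^ (1 / 2 : ℝ) * M * (1 + D2v τ) := by ring
  have hvol : volume (Ioo (0 : ℝ) T) ≠ ⊤ := by simp
  refine lt_of_le_of_lt (setLIntegral_mono' measurableSet_Ioo hpt) ?_
  rw [lintegral_const_mul' _ _ ENNReal.coe_ne_top,
    lintegral_add_left' (((mP.const_add _)).const_mul _), lintegral_const_mul' _ _ ENNReal.coe_ne_top,
    lintegral_add_left measurable_const, setLIntegral_const, lintegral_const_mul' _ _ hBM,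
    lintegral_add_left measurable_const, setLIntegral_const]
  refine ENNReal.mul_lt_top ENNReal.coe_lt_top (ENNReal.add_lt_top.2 ⟨?_, ?_⟩)
  · exact ENNReal.mul_lt_top ENNReal.coe_lt_top
      (ENNReal.add_lt_top.2 ⟨ENNReal.mul_lt_top hM.lt_top hvol.lt_top, hPT⟩)
  · exact ENNReal.mul_lt_top hBM.lt_top
      (ENNReal.add_lt_top.2 ⟨ENNReal.mul_lt_top ENNReal.one_lt_top hvol.lt_top, h2v⟩)

/-- **The key slice estimate** (Hölder, `|curl ω| ≤ κ ‖∇ω‖`, the transport bound and Young twice):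
for every `ε ∈ (0, ∞)` there are finite `K₃, K₄` with
`2 ∫ |G| |curl ω| ≤ 2ε ∫ |∇ω|²_F + (K₃ + K₄ ‖D²v(τ)‖_{L²}) ∫ |ω|²` for all `τ ∈ [0, T]`. [folklore] -/
theorem IsClassicalNSSolutionOn.exists_slice_estimate_sub
    (hu : IsClassicalNSSolutionOn (Icc 0 T) ν f u p)
    (hv : IsClassicalNSSolutionOn (Icc 0 T) ν f v q)
    (hXu : FluidPDE.MemSobolevX 1 T u) (hXv : FluidPDE.MemSobolevX 1 T v) {ε : ℝ≥0∞} (hε0 : ε ≠ 0) (hε : ε ≠ ⊤) :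
    ∃ K₃ K₄ : ℝ≥0∞, K₃ ≠ ⊤ ∧ K₄ ≠ ⊤ ∧ ∀ τ ∈ Icc 0 T,
      2 * ∫⁻ x, ‖convect (u τ) ((u - v) τ) x + convect ((u - v) τ) (v τ) x‖ₑ *
          ‖curl (curl ((u - v) τ)) x‖ₑ ≤
        (ε + ε) * (∫⁻ x, ENNReal.ofReal (frobeniusNormSq (fderiv ℝ (curl ((u - v) τ)) x))) +
          (K₃ + K₄ * (∫⁻ x, ‖iteratedFDeriv ℝ 2 (v τ) x‖ₑ ^ 2) ^ (1 / 2 : ℝ)) *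
            ∫⁻ x, ‖curl ((u - v) τ) x‖ₑ ^ 2 := by
  obtain ⟨C, hC⟩ := exists_lintegral_transport_sq_le
  obtain ⟨A, hA⟩ := exists_lintegral_enorm_fderiv_sq_le_of_memSobolevX hXu
  obtain ⟨B, hB⟩ := exists_lintegral_enorm_fderiv_sq_le_of_memSobolevX hXv
  obtain ⟨K, hK, hY⟩ := exists_young_half hε0 hε
  set κ₂ : ℝ≥0∞ := (ENNReal.ofReal (‖curlCLM‖ ^ 2)) ^ (1 / 2 : ℝ) with hκ₂def
  have hκ₂ : κ₂ ≠ ⊤ := ENNReal.rpow_ne_top_of_nonneg (by norm_num) ENNReal.ofReal_ne_top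
  set U₁ : ℝ≥0∞ := 2 * κ₂ with hU₁def
  have hU₁ : U₁ ≠ ⊤ := ENNReal.mul_ne_top ENNReal.ofNat_ne_top hκ₂
  set U₂ : ℝ≥0∞ := K * U₁ ^ 2 * C * A with hU₂def
  have hU₂ : U₂ ≠ ⊤ := ENNReal.mul_ne_top
    (ENNReal.mul_ne_top (ENNReal.mul_ne_top hK (ENNReal.pow_ne_top hU₁)) ENNReal.coe_ne_top)
    ENNReal.coe_ne_top
  have hB2 : (B : ℝ≥0∞) ^ (1 / 2 : ℝ) ≠ ⊤ :=
    ENNReal.rpow_ne_top_of_nonneg (by norm_num) ENNReal.coe_ne_top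
  refine ⟨K * U₂ ^ 2, K * U₁ ^ 2 * C * (B : ℝ≥0∞) ^ (1 / 2 : ℝ),
    ENNReal.mul_ne_top hK (ENNReal.pow_ne_top hU₂),
    ENNReal.mul_ne_top (ENNReal.mul_ne_top (ENNReal.mul_ne_top hK (ENNReal.pow_ne_top hU₁))
      ENNReal.coe_ne_top) hB2, fun τ hτ => ?_⟩
  -- the quantities at time `τ`
  set Ω : ℝ≥0∞ := ∫⁻ x, ‖curl ((u - v) τ) x‖ₑ ^ 2 with hΩ
  set P : ℝ≥0∞ := ∫⁻ x, ENNReal.ofReal (frobeniusNormSq (fderiv ℝ (curl ((u - v) τ)) x)) with hP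
  set Γ : ℝ≥0∞ := ∫⁻ x, ‖convect (u τ) ((u - v) τ) x + convect ((u - v) τ) (v τ) x‖ₑ ^ 2 with hΓ
  set Q : ℝ≥0∞ := ∫⁻ x, ‖curl (curl ((u - v) τ)) x‖ₑ ^ 2 with hQ
  set Dv : ℝ≥0∞ := (∫⁻ x, ‖iteratedFDeriv ℝ 2 (v τ) x‖ₑ ^ 2) ^ (1 / 2 : ℝ) with hDv
  have huI : ContDiff ℝ ∞ (u τ) := hu.contDiff_velocity hτ
  have hvI : ContDiff ℝ ∞ (v τ) := hv.contDiff_velocity hτ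
  have hwI : ContDiff ℝ ∞ ((u - v) τ) := huI.sub hvI
  have hw1 : ContDiff ℝ 1 ((u - v) τ) := hwI.of_le (by norm_cast)
  -- transport bound
  have hΓle : Γ ≤ C * (A * Ω ^ (1 / 2 : ℝ) * P ^ (1 / 2 : ℝ) + (B : ℝ≥0∞) ^ (1 / 2 : ℝ) * Dv * Ω) :=
    hC (u τ) (v τ) huI hvI (hu.divFree τ hτ) (hv.divFree τ hτ)
      (lintegral_enorm_sq_lt_top_of_memSobolevX hXu hτ)
      (lintegral_enorm_sq_lt_top_of_memSobolevX hXv hτ) A B ENNReal.coe_ne_top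
      ENNReal.coe_ne_top (hA τ hτ) (hB τ hτ)
  -- `∫ |curl ω|² ≤ κ² ∫ |∇ω|²`
  have hQle : Q ≤ ENNReal.ofReal (‖curlCLM‖ ^ 2) * P := by
    calc Q ≤ ENNReal.ofReal (‖curlCLM‖ ^ 2) * ∫⁻ x, ‖fderiv ℝ (curl ((u - v) τ)) x‖ₑ ^ 2 :=
          lintegral_enorm_curl_sq_le _
      _ ≤ ENNReal.ofReal (‖curlCLM‖ ^ 2) * P := by
          gcongr
          exact lintegral_mono fun x => sq_enorm_le_ofReal_frobeniusNormSq _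
  -- Cauchy–Schwarz
  have mG : AEMeasurable (fun x => ‖convect (u τ) ((u - v) τ) x + convect ((u - v) τ) (v τ) x‖ₑ)
      volume := by
    refine (Continuous.aestronglyMeasurable ?_).enorm
    simp only [convect]
    exact ((hw1.continuous_fderiv one_ne_zero).clm_apply huI.continuous).add
      (((hvI.of_le (by norm_cast) : ContDiff ℝ 1 (v τ)).continuous_fderiv one_ne_zero).clm_apply
        hwI.continuous)
  have mW : AEMeasurable (fun x => ‖curl (curl ((u - v) τ)) x‖ₑ) volume :=
    (continuous_curl (contDiff_curl (n := 1)
      (hwI.of_le (by norm_cast)))).aestronglyMeasurable.enorm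
  have hCS : ∫⁻ x, ‖convect (u τ) ((u - v) τ) x + convect ((u - v) τ) (v τ) x‖ₑ *
      ‖curl (curl ((u - v) τ)) x‖ₑ ≤ Γ ^ (1 / 2 : ℝ) * Q ^ (1 / 2 : ℝ) :=
    lintegral_mul_le_sqrt_mul_sqrt mG mW
  -- Step 1
  have h1 : 2 * ∫⁻ x, ‖convect (u τ) ((u - v) τ) x + convect ((u - v) τ) (v τ) x‖ₑ *
      ‖curl (curl ((u - v) τ)) x‖ₑ ≤ U₁ * Γ ^ (1 / 2 : ℝ) * P ^ (1 / 2 : ℝ) := by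
    calc 2 * ∫⁻ x, ‖convect (u τ) ((u - v) τ) x + convect ((u - v) τ) (v τ) x‖ₑ *
          ‖curl (curl ((u - v) τ)) x‖ₑ
        ≤ 2 * (Γ ^ (1 / 2 : ℝ) * Q ^ (1 / 2 : ℝ)) := by gcongr
      _ ≤ 2 * (Γ ^ (1 / 2 : ℝ) * (ENNReal.ofReal (‖curlCLM‖ ^ 2) * P) ^ (1 / 2 : ℝ)) := by
          gcongr
      _ = U₁ * Γ ^ (1 / 2 : ℝ) * P ^ (1 / 2 : ℝ) := by
          rw [ENNReal.mul_rpow_of_nonneg _ _ (by norm_num), hU₁def, hκ₂def]; ring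
  -- Step 2: Young
  have h2 : U₁ * Γ ^ (1 / 2 : ℝ) * P ^ (1 / 2 : ℝ) ≤ ε * P + K * U₁ ^ 2 * Γ := hY U₁ Γ P
  -- Step 3: transport bound inserted
  have h3 : K * U₁ ^ 2 * Γ ≤ U₂ * Ω ^ (1 / 2 : ℝ) * P ^ (1 / 2 : ℝ) +
      K * U₁ ^ 2 * C * (B : ℝ≥0∞) ^ (1 / 2 : ℝ) * Dv * Ω := by
    calc K * U₁ ^ 2 * Γ
        ≤ K * U₁ ^ 2 * (C * (A * Ω ^ (1 / 2 : ℝ) * P ^ (1 / 2 : ℝ) +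
            (B : ℝ≥0∞) ^ (1 / 2 : ℝ) * Dv * Ω)) := by gcongr
      _ = _ := by rw [hU₂def]; ring
  -- Step 4: Young again
  have h4 : U₂ * Ω ^ (1 / 2 : ℝ) * P ^ (1 / 2 : ℝ) ≤ ε * P + K * U₂ ^ 2 * Ω := hY U₂ Ω P
  calc 2 * ∫⁻ x, ‖convect (u τ) ((u - v) τ) x + convect ((u - v) τ) (v τ) x‖ₑ *
          ‖curl (curl ((u - v) τ)) x‖ₑ
      ≤ U₁ * Γ ^ (1 / 2 : ℝ) * P ^ (1 / 2 : ℝ) := h1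
    _ ≤ ε * P + K * U₁ ^ 2 * Γ := h2
    _ ≤ ε * P + (U₂ * Ω ^ (1 / 2 : ℝ) * P ^ (1 / 2 : ℝ) +
          K * U₁ ^ 2 * C * (B : ℝ≥0∞) ^ (1 / 2 : ℝ) * Dv * Ω) := add_le_add le_rfl h3
    _ ≤ ε * P + ((ε * P + K * U₂ ^ 2 * Ω) +
          K * U₁ ^ 2 * C * (B : ℝ≥0∞) ^ (1 / 2 : ℝ) * Dv * Ω) := by gcongr
    _ = (ε + ε) * P + (K * U₂ ^ 2 + K * U₁ ^ 2 * C * (B : ℝ≥0∞) ^ (1 / 2 : ℝ) * Dv) * Ω := by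
        ring

end APriori

/-! ### Conclusion from vanishing enstrophy -/

/-- A smooth divergence-free `L²` field with vanishing vorticity vanishes (div–curl estimate,
constancy, infinite volume). [folklore] -/
theorem eq_zero_of_lintegral_curl_sq_eq_zero {w : EuclideanSpace ℝ (Fin 3) → EuclideanSpace ℝ (Fin 3)} (hw : ContDiff ℝ ∞ w)
    (hdiv : VectorCalculus.IsDivFree w) (hL2 : ∫⁻ x, ‖w x‖ₑ ^ 2 < ⊤) (hΩ : ∫⁻ x, ‖curl w x‖ₑ ^ 2 = 0) :
    w = 0 := by
  obtain ⟨K, hK⟩ := FluidPDE.tao2011_sobolev_of_vorticity_holds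
  obtain ⟨h1, -⟩ := hK hw hdiv hL2
  have hw1 : ContDiff ℝ 1 w := hw.of_le (by norm_cast)
  have hcD : Continuous (fderiv ℝ w) := hw1.continuous_fderiv one_ne_zero
  have hD0 : ∫⁻ x, ‖fderiv ℝ w x‖ₑ ^ 2 = 0 := by
    rw [hΩ, mul_zero] at h1
    simpa only [FluidPDE.enorm_iteratedFDeriv_one] using nonpos_iff_eq_zero.1 h1
  have hae : (fun x => ‖fderiv ℝ w x‖ₑ ^ 2) =ᵐ[volume] 0 :=
    (lintegral_eq_zero_iff ((continuous_enorm.comp hcD).measurable.pow_const 2)).1 hD0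
  have hae' : fderiv ℝ w =ᵐ[volume] fun _ => 0 := by
    filter_upwards [hae] with x hx
    have h2 : ‖fderiv ℝ w x‖ₑ ^ 2 = 0 := hx
    have h3 : ‖fderiv ℝ w x‖ₑ = 0 := by simpa using h2
    rwa [← ofReal_norm, ENNReal.ofReal_eq_zero, norm_le_zero_iff] at h3
  have hD : fderiv ℝ w = fun _ => 0 := (Continuous.ae_eq_iff_eq volume hcD continuous_const).1 hae'
  have hconst : ∀ x, w x = w 0 := fun x =>
    is_const_of_fderiv_eq_zero (hw1.differentiable one_ne_zero) (fun y => congrFun hD y) x 0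
  have hw0 : w 0 = 0 := by
    by_contra h
    have hpos : ‖w 0‖ₑ ^ 2 ≠ 0 := by simpa using h
    have : ∫⁻ x : EuclideanSpace ℝ (Fin 3), ‖w x‖ₑ ^ 2 = ⊤ := by
      calc ∫⁻ x : EuclideanSpace ℝ (Fin 3), ‖w x‖ₑ ^ 2 = ∫⁻ _ : EuclideanSpace ℝ (Fin 3), ‖w 0‖ₑ ^ 2 := lintegral_congr fun x => by rw [hconst x]
        _ = ‖w 0‖ₑ ^ 2 * volume (univ : Set (EuclideanSpace ℝ (Fin 3))) := lintegral_const _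
        _ = ⊤ := by
            rw [measure_univ_of_isAddLeftInvariant]
            exact ENNReal.mul_top hpos
    exact hL2.ne this
  funext x
  rw [hconst x, hw0]
  rfl

/-! ### The theorem -/

section Conclusion

variable {T ν : ℝ} {f u v : ℝ → EuclideanSpace ℝ (Fin 3) → EuclideanSpace ℝ (Fin 3)}
  {p q : ℝ → EuclideanSpace ℝ (Fin 3) → ℝ}

/-- **Uniqueness of classical solutions in `X¹` (Tao 2011, Cor. 4.3 + Thm. 5.4 (iii), with a
general smooth forcing).** Two classical solutions `(u, p)`, `(v, q)` of the Navier–Stokes system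
on `[0, T] × ℝ³` with the same viscosity `ν > 0` and forcing `f`, both in
`X¹ = L^∞_t H¹_x ∩ L²_t H²_x`, with `u(0) = v(0)`, satisfy `u(t) = v(t)` for all `t ∈ [0, T]`
(no hypothesis on the pressures). Proof: the enstrophy inequality for `ω = curl (u − v)`
(`enstrophy_sub_le`, fed with the a priori bounds `exists_lintegral_curl_sub_sq_le`,
`lintegral_dissipation_sub_lt_top`, `lintegral_transport_sub_lt_top`), the slice estimate
`exists_slice_estimate_sub` with `ε = ν/2`, absorption of `ν∫∫|∇ω|²`, the integral Grönwall lemma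
`NS.lintegral_gronwall_eq_zero` with kernel `K₃ + K₄‖D²v(τ)‖_{L²} ∈ L¹(0,T)`, and
`eq_zero_of_lintegral_curl_sq_eq_zero` at each time. (Tao proves the unforced case via mild
solutions; the vorticity route is Majda–Bertozzi §3.2.)
[cite: Tao2011, Cor. 4.3 + Thm. 5.4 (iii); Remark 11.3] -/
theorem IsClassicalNSSolutionOn.eq_of_memSobolevX
    (hu : IsClassicalNSSolutionOn (Icc 0 T) ν f u p)
    (hv : IsClassicalNSSolutionOn (Icc 0 T) ν f v q) (hν : 0 < ν) (hT : 0 < T)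
    (hXu : FluidPDE.MemSobolevX 1 T u) (hXv : FluidPDE.MemSobolevX 1 T v) (h0 : u 0 = v 0)
    {t : ℝ} (ht : t ∈ Icc 0 T) : u t = v t := by
  -- notation
  set Ω : ℝ → ℝ≥0∞ := fun τ => ∫⁻ x, ‖curl ((u - v) τ) x‖ₑ ^ 2 with hΩ
  set P : ℝ → ℝ≥0∞ := fun τ =>
    ∫⁻ x, ENNReal.ofReal (frobeniusNormSq (fderiv ℝ (curl ((u - v) τ)) x)) with hP
  set L : ℝ → ℝ≥0∞ := fun τ => ∫⁻ x, ‖convect (u τ) ((u - v) τ) x + convect ((u - v) τ) (v τ) x‖ₑ *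
    ‖curl (curl ((u - v) τ)) x‖ₑ with hL
  set D2v : ℝ → ℝ≥0∞ := fun τ => ∫⁻ x, ‖iteratedFDeriv ℝ 2 (v τ) x‖ₑ ^ 2 with hD2v
  set ν' : ℝ≥0∞ := ENNReal.ofReal ν with hν'
  have hν'0 : ν' ≠ 0 := (ENNReal.ofReal_pos.2 hν).ne'
  have hε0 : ν' / 2 ≠ 0 := (ENNReal.half_pos hν'0).ne'
  have hε : ν' / 2 ≠ ⊤ := ENNReal.div_ne_top ENNReal.ofReal_ne_top two_ne_zero
  -- a priori bounds
  obtain ⟨M, hM, hΩM⟩ :=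
    exists_lintegral_curl_sub_sq_le hu.smooth_velocity hv.smooth_velocity hXu hXv
  have hPT := lintegral_dissipation_sub_lt_top hu.smooth_velocity hv.smooth_velocity hXu hXv hT
  have hΓT := hu.lintegral_transport_sub_lt_top hv hXu hXv hT
  have mP : ∀ {T' : ℝ}, T' ≤ T → AEMeasurable P ((volume : Measure ℝ).restrict (Ioo 0 T')) :=
    fun hT' => hu.smooth_velocity.aemeasurable_dissipation_sub hv.smooth_velocity hT hT'
  obtain ⟨K₃, K₄, hK₃, hK₄, hS⟩ := hu.exists_slice_estimate_sub hv hXu hXv hε0 hε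
  -- the enstrophy inequality for the difference
  have hE : ∀ s ∈ Icc 0 T, Ω s + 2 * ν' * ∫⁻ τ in Ioo 0 s, P τ ≤ 2 * ∫⁻ τ in Ioo 0 s, L τ :=
    fun s hs => hu.enstrophy_sub_le hv hT hν.le h0 hM hΩM hPT hΓT hs
  -- absorption
  set g : ℝ → ℝ≥0∞ := fun τ => K₃ + K₄ * D2v τ ^ (1 / 2 : ℝ) with hg
  have hmain : ∀ s ∈ Ioc 0 T, Ω s ≤ 1 * ∫⁻ τ in Ioo 0 s, g τ * Ω τ := by
    intro s hs
    have hs' : s ∈ Icc 0 T := ⟨hs.1.le, hs.2⟩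
    have hsub : Ioo 0 s ⊆ Ioo 0 T := Ioo_subset_Ioo le_rfl hs.2
    set D : ℝ≥0∞ := ∫⁻ τ in Ioo 0 s, P τ with hD
    have hDtop : ν' * D ≠ ⊤ :=
      ENNReal.mul_ne_top ENNReal.ofReal_ne_top ((lintegral_mono_set hsub).trans_lt hPT).ne
    have e1 : 2 * ∫⁻ τ in Ioo 0 s, L τ ≤ ν' * D + ∫⁻ τ in Ioo 0 s, g τ * Ω τ := by
      rw [← lintegral_const_mul' 2 _ ENNReal.ofNat_ne_top]
      calc ∫⁻ τ in Ioo 0 s, 2 * L τ ≤ ∫⁻ τ in Ioo 0 s, ((ν' / 2 + ν' / 2) * P τ + g τ * Ω τ) :=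
            setLIntegral_mono' measurableSet_Ioo fun τ hτ => hS τ ⟨hτ.1.le, hτ.2.le.trans hs.2⟩
        _ = ν' * D + ∫⁻ τ in Ioo 0 s, g τ * Ω τ := by
            rw [ENNReal.add_halves, lintegral_add_left' ((mP hs.2).const_mul ν'),
              lintegral_const_mul' _ _ ENNReal.ofReal_ne_top]
    have e2 : ν' * D + (Ω s + ν' * D) ≤ ν' * D + ∫⁻ τ in Ioo 0 s, g τ * Ω τ := by
      calc ν' * D + (Ω s + ν' * D) = Ω s + 2 * ν' * D := by ring
        _ ≤ 2 * ∫⁻ τ in Ioo 0 s, L τ := hE s hs'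
        _ ≤ _ := e1
    calc Ω s ≤ Ω s + ν' * D := le_self_add
      _ ≤ ∫⁻ τ in Ioo 0 s, g τ * Ω τ := (ENNReal.add_le_add_iff_left hDtop).1 e2
      _ = 1 * _ := (one_mul _).symm
  -- the Grönwall kernel is integrable
  have hgT : ∫⁻ τ in Ioo 0 T, g τ ≠ ⊤ := by
    have h2v : ∫⁻ τ in Ioo 0 T, D2v τ < ⊤ := hXv.2
    have hvol : volume (Ioo (0 : ℝ) T) ≠ ⊤ := by simp
    refine ne_top_of_le_ne_top ?_ (lintegral_mono (μ := (volume : Measure ℝ).restrict (Ioo 0 T))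
      fun τ => show g τ ≤ K₃ + K₄ * (1 + D2v τ) by
        simp only [hg]; gcongr; exact ennreal_rpow_half_le_one_add _)
    rw [lintegral_add_left measurable_const, setLIntegral_const, lintegral_const_mul' _ _ hK₄,
      lintegral_add_left measurable_const, setLIntegral_const]
    exact ENNReal.add_ne_top.2 ⟨ENNReal.mul_ne_top hK₃ hvol,
      ENNReal.mul_ne_top hK₄ (ENNReal.add_ne_top.2 ⟨by simp, h2v.ne⟩)⟩
  -- Grönwall
  rcases ht.1.eq_or_lt with h | ht0
  · subst h; exact h0
  have hΩ0 : Ω t = 0 :=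
    FluidPDE.lintegral_gronwall_eq_zero (φ := Ω) (a := g) ENNReal.one_ne_top hM
      (fun s hs => hΩM s ⟨hs.1.le, hs.2⟩) hgT hmain t ⟨ht0, ht.2⟩
  -- conclusion
  have hL2w : ∫⁻ x, ‖(u - v) t x‖ₑ ^ 2 < ⊤ := by
    calc ∫⁻ x, ‖(u - v) t x‖ₑ ^ 2 = ∫⁻ x, ‖u t x - v t x‖ₑ ^ 2 := rfl
      _ ≤ 2 * (∫⁻ x, ‖u t x‖ₑ ^ 2) + 2 * ∫⁻ x, ‖v t x‖ₑ ^ 2 :=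
          lintegral_enorm_sub_sq_le (hu.contDiff_velocity ht).continuous
      _ < ⊤ := ENNReal.add_lt_top.2
          ⟨ENNReal.mul_lt_top ENNReal.ofNat_lt_top (lintegral_enorm_sq_lt_top_of_memSobolevX hXu ht),
            ENNReal.mul_lt_top ENNReal.ofNat_lt_top (lintegral_enorm_sq_lt_top_of_memSobolevX hXv ht)⟩
  have hw0 : (u - v) t = 0 :=
    eq_zero_of_lintegral_curl_sq_eq_zero ((hu.contDiff_velocity ht).sub (hv.contDiff_velocity ht))
      (hu.isDivFree_sub hv ht) hL2w hΩ0
  funext x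
  have := congrFun hw0 x
  simpa [sub_eq_zero] using this

/-- The same statement in the shape of the named fact `NS.tao2011_velocity_eq_of_memSobolevX`
(unforced, `∀ t ∈ Icc 0 T`), for a general forcing. [cite: Tao2011, Cor. 4.3 + Thm. 5.4 (iii)] -/
theorem IsClassicalNSSolutionOn.velocity_eq_of_memSobolevX
    (hu : IsClassicalNSSolutionOn (Icc 0 T) ν f u p)
    (hv : IsClassicalNSSolutionOn (Icc 0 T) ν f v q) (hν : 0 < ν) (hT : 0 < T)
    (hXu : FluidPDE.MemSobolevX 1 T u) (hXv : FluidPDE.MemSobolevX 1 T v) (h0 : u 0 = v 0) :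
    ∀ t ∈ Icc 0 T, u t = v t :=
  fun _ ht => hu.eq_of_memSobolevX hv hν hT hXu hXv h0 ht

end Conclusion

end Literature.Analysis.FluidPDE

/-! ## Discharges

Consequences for the decomposition of Tao's Cor. 11.4 kept in `NSUnconditionalUniquenessProofs.lean`
(named facts `NS.tao2011_velocity_eq_of_memSobolevX`, `NS.tao2011_velocity_eq_of_isMildNSSolutionOn`
and the assemblies `NS.tao_unconditional_uniqueness_velocity_of_parts`, `…_iff`) and in
`TaoEnstrophyLocalisation.lean` (`NS.tao2011_boundedEnstrophy_of_parts`). -/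

namespace Literature.Analysis.FluidPDE

/-- **Tao 2011, Cor. 4.3 + Thm. 5.4 (iii) (composite), discharged**: two classical solutions of
the unforced system on `[0, T] × ℝ³` in `X¹` with the same datum coincide — the specialisation
`f = 0` of `Fluid.IsClassicalNSSolutionOn.velocity_eq_of_memSobolevX` (vorticity energy method,
this file). [cite: Tao2011, Cor. 4.3 + Thm. 5.4 (iii)] -/
theorem tao2011_velocity_eq_of_memSobolevX_holds : tao2011_velocity_eq_of_memSobolevX :=
  fun _ν _T hν hT _u _v _p _q hu hv hXu hXv h0 =>
    hu.velocity_eq_of_memSobolevX hv hν hT hXu hXv h0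

/-- **Tao 2011, Thm. 5.4 (iii) node, discharged** (a formal consequence of the composite,
`tao2011_velocity_eq_of_isMildNSSolutionOn_of_memSobolevX`). [cite: Tao2011, Thm. 5.4 (iii)] -/
theorem tao2011_velocity_eq_of_isMildNSSolutionOn_holds :
    tao2011_velocity_eq_of_isMildNSSolutionOn :=
  tao2011_velocity_eq_of_isMildNSSolutionOn_of_memSobolevX tao2011_velocity_eq_of_memSobolevX_holds

/-- **Cor. 11.4 (velocity form) from Cor. 11.1 alone**: with steps 2–3 of Remark 11.3's chain
discharged, unconditional uniqueness follows from bounded enstrophy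
(`tao2011_boundedEnstrophy`). [cite: Tao2011, Cor. 11.4 (Remark 11.3)] -/
theorem tao_unconditional_uniqueness_velocity_of_boundedEnstrophy
    (hA : tao2011_boundedEnstrophy) : tao_unconditional_uniqueness_velocity :=
  tao_unconditional_uniqueness_velocity_of_parts hA tao2011_velocity_eq_of_memSobolevX_holds

/-- The same for Cor. 11.4 as printed (normalised pressures) and for the duplicate vendoring
`tao_finite_energy_velocity_uniqueness` (`NSFiniteEnergyUniqueness.lean`), from Cor. 11.1 alone.
[cite: Tao2011, Cor. 11.4 (Remark 11.3)] -/
theorem tao_unconditional_uniqueness_of_boundedEnstrophy (hA : tao2011_boundedEnstrophy) :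
    tao_unconditional_uniqueness ∧ tao_finite_energy_velocity_uniqueness :=
  ⟨tao_unconditional_uniqueness.of_velocity (tao_unconditional_uniqueness_velocity_of_boundedEnstrophy hA),
    tao_unconditional_uniqueness_velocity_iff.1
      (tao_unconditional_uniqueness_velocity_of_boundedEnstrophy hA)⟩

/-- **Cor. 11.4 (velocity form) from Thm. 10.1 alone**: Cor. 11.1 is proved in
`TaoEnstrophyLocalisation.lean` from the exterior enstrophy localisation
`tao2011_enstrophyLocalisation_exterior` (Thm. 10.1) and the Fourier step
`tao2011_sobolev_of_vorticity`, discharged in `TaoEnstrophyLocalisationProofs.lean`; so Thm. 10.1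
(exterior form) is the only remaining named fact behind Cor. 11.4 at this layer.
[cite: Tao2011, Cor. 11.4 (Remark 11.3, Cor. 11.1)] -/
theorem tao_unconditional_uniqueness_velocity_of_enstrophyLocalisation
    (hA : tao2011_enstrophyLocalisation_exterior) : tao_unconditional_uniqueness_velocity :=
  tao_unconditional_uniqueness_velocity_of_boundedEnstrophy
    (tao2011_boundedEnstrophy_of_parts hA tao2011_sobolev_of_vorticity_holds)

/-- The same for Cor. 11.4 as printed (normalised pressures) and for the duplicate vendoring
`tao_finite_energy_velocity_uniqueness` (`NSFiniteEnergyUniqueness.lean`). [cite: Tao2011, Cor. 11.4] -/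
theorem tao_unconditional_uniqueness_of_enstrophyLocalisation
    (hA : tao2011_enstrophyLocalisation_exterior) :
    tao_unconditional_uniqueness ∧ tao_finite_energy_velocity_uniqueness :=
  ⟨tao_unconditional_uniqueness.of_velocity
      (tao_unconditional_uniqueness_velocity_of_enstrophyLocalisation hA),
    tao_unconditional_uniqueness_velocity_iff.1
      (tao_unconditional_uniqueness_velocity_of_enstrophyLocalisation hA)⟩

end Literature.Analysis.FluidPDE

end
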